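import Mathlib.MeasureTheory.Integral.IntegralEqImproper
import Literature.Analysis.FluidPDE.SawtoothCascadeDriftFree
import Literature.Analysis.FluidPDE.PassiveScalarClassicalEnergy
import Literature.Analysis.FluidPDE.TorusClassicalLerayHopfProofs
import Literature.Analysis.FluidPDE.CheskidovAssemblyTools
import Literature.Analysis.FunctionSpaces.TorusClassicalNSGluing
import Literature.Analysis.FunctionSpaces.TorusDiffMonomialBounds
import Literature.Analysis.FunctionSpaces.TorusCoordinateFunctions
import HarnessLib
import Summits.AnomalousDissipation.AnomalousDissipation.Theses.SawtoothPulseCascade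

/-!
# K3loc, line `DriftFree` — helper: energy bookkeeping up to `t = 1` and the `2½`-D dissipation floor

Helper file of the lead prover for the crux `K3LocalisedClosure` (stmt-AnomalousDissipation-19492), route
`SawtoothPulseCascade`, line `DriftFree` (skeleton v3).  Contents (all elementary, on the vocabulary
`Literature/Analysis/FluidPDE/SawtoothCascadeDriftFree` and the tree's classical Navier–Stokes / passive-scalar energy
identities):

* §1 a real-analysis helper: a nonnegative function continuous on `[0,1)` with bounded partial integrals is interval
  integrable on `[0,1]` (Mathlib `integrableOn_Ioc_of_intervalIntegral_norm_bounded`) — the tool that turns the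
  energy bounds below into honest (non-junk) values of `Torus.cumulativeDissipation … 0 1`;
* §2 the datum `θ₀ = sin 2πx₁`: smooth, `|θ₀| ≤ 1`, `‖θ₀‖²_{L²} > 0`;
* §3 for a classical planar Navier–Stokes solution on `[0,1)` from rest with a force bounded by `C`:
  `½‖V(t)‖² ≤ C²/2` and `ν∫₀ᵗ‖∇V‖² ≤ C²` for all `t < 1` (energy balance
  `Torus.IsClassicalNSSolutionOn.energy_balance_holds` / `energy_eq`, Cauchy–Schwarz, and the `√`-comparison lemma
  `FluidPDE.Torus.sqrt_le_sqrt_add_integral_of_hasDerivWithinAt` of Bruè–De Lellis' Lemma 7);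
* §4 for its transported scalar `R`: `ν∫₀ᵗ‖∇R‖² ≤ ‖R(0)‖²/2`, and the DISSIPATION FLOOR of the lift
  `u = (V, R)∘π`: `ν∫₀ᵀ‖∇R‖² ≤ cumulativeDissipation ν u 0 1` for every `T < 1` (`‖∇u‖² = ‖∇V‖² + ‖∇R‖²`,
  `Torus.gradNormSq_twoHalf`, Cheskidov 2023 §6 p. 19).
-/

-- `Summit.<Summit>.<Problem>`: single-conjunct summit, the duplicate namespace segment is deliberate.
set_option linter.dupNamespace false

noncomputable section

namespace Summit.AnomalousDissipation.AnomalousDissipation.Theorems.SawtoothPulseCascade.DriftFreeClosure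

open scoped InnerProductSpace ENNReal NNReal
open MeasureTheory Set Filter Topology
open Literature.Analysis Literature.Analysis.FunctionSpaces Literature.Analysis.FluidPDE
open Literature.Analysis.FluidPDE.SawtoothCascade
open Literature.Analysis.FluidPDE.SawtoothCascade.DriftFree
open Literature.Analysis.FunctionSpaces.Torus (twoHalf planarProj)

/-! ## §1 A real-analysis helper: integrability on `(0,1)` from bounded partial integrals -/

/-- A nonnegative function continuous on `[0,1)` whose partial integrals `∫₀ᵗ` are bounded for `t < 1` is
interval integrable on `[0,1]` (monotone convergence / `integrableOn_Ioc_of_intervalIntegral_norm_bounded`). [folklore] -/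
theorem intervalIntegrable_of_integral_le {g : ℝ → ℝ} {B : ℝ}
    (hc : ContinuousOn g (Ico (0 : ℝ) 1)) (hnn : ∀ t ∈ Ico (0 : ℝ) 1, 0 ≤ g t)
    (hB : ∀ t ∈ Ico (0 : ℝ) 1, ∫ s in (0 : ℝ)..t, g s ≤ B) :
    IntervalIntegrable g volume 0 1 := by
  rw [intervalIntegrable_iff_integrableOn_Ioc_of_le zero_le_one]
  set b : ℕ → ℝ := fun i => 1 - 1 / ((i : ℝ) + 2) with hb
  have hb_lt : ∀ i, b i < 1 := fun i => by
    have : (0 : ℝ) < 1 / ((i : ℝ) + 2) := by positivity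
    simp only [hb]; linarith
  have hb_nonneg : ∀ i, 0 ≤ b i := fun i => by
    have h2 : (2 : ℝ) ≤ (i : ℝ) + 2 := by
      have : (0 : ℝ) ≤ i := Nat.cast_nonneg i
      linarith
    have : 1 / ((i : ℝ) + 2) ≤ 1 / 2 := one_div_le_one_div_of_le (by norm_num) h2
    simp only [hb]; linarith
  have hsub : ∀ i, Icc 0 (b i) ⊆ Ico (0 : ℝ) 1 := fun i => Icc_subset_Ico_right (hb_lt i)
  have hfi : ∀ i, IntegrableOn g (Ioc 0 (b i)) volume := fun i =>
    ((hc.mono (hsub i)).integrableOn_compact isCompact_Icc).mono_set Ioc_subset_Icc_self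
  have htend : Tendsto b atTop (𝓝 1) := by
    have h1 : Tendsto (fun i : ℕ => 1 / ((i : ℝ) + 2)) atTop (𝓝 0) := by
      have h := tendsto_one_div_add_atTop_nhds_zero_nat (𝕜 := ℝ)
      have h' : Tendsto (fun i : ℕ => 1 / ((↑(i + 1) : ℝ) + 1)) atTop (𝓝 0) :=
        h.comp (tendsto_add_atTop_nat 1)
      refine h'.congr fun i => ?_
      push_cast; ring_nf
    have : Tendsto (fun i : ℕ => (1 : ℝ) - 1 / ((i : ℝ) + 2)) atTop (𝓝 (1 - 0)) :=
      tendsto_const_nhds.sub h1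
    simpa [hb] using this
  refine integrableOn_Ioc_of_intervalIntegral_norm_bounded_right (l := atTop) (I := B) hfi htend ?_
  refine Eventually.of_forall fun i => ?_
  have heq : ∫ x in Ioc 0 (b i), ‖g x‖ = ∫ x in Ioc 0 (b i), g x := by
    refine setIntegral_congr_fun measurableSet_Ioc fun x hx => ?_
    rw [Real.norm_eq_abs, abs_of_nonneg (hnn x ⟨hx.1.le, hx.2.trans_lt (hb_lt i)⟩)]
  rw [heq, ← intervalIntegral.integral_of_le (hb_nonneg i)]
  exact hB (b i) ⟨hb_nonneg i, hb_lt i⟩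

/-- Lower Riemann sums: for `g ≥ 0` interval integrable on `[0,1]` and `T ∈ [0,1]`, `∫₀ᵀ g ≤ ∫₀¹ g`. [folklore] -/
theorem integral_le_integral_of_nonneg {g : ℝ → ℝ} (hgi : IntervalIntegrable g volume 0 1)
    (hnn : ∀ t ∈ Ioc (0 : ℝ) 1, 0 ≤ g t) {T : ℝ} (hT0 : 0 ≤ T) (hT1 : T ≤ 1) :
    ∫ s in (0 : ℝ)..T, g s ≤ ∫ s in (0 : ℝ)..1, g s :=
  intervalIntegral.integral_mono_interval le_rfl hT0 hT1
    ((ae_restrict_iff' measurableSet_Ioc).2 (Eventually.of_forall hnn)) hgi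

/-! ## §2 The datum `sin 2πx₁`: smooth, bounded by one, positive energy -/

/-- The periodic lift of `datum` is `y ↦ sin (2π y₀)`. [folklore] -/
theorem lift_datum : FunctionSpaces.Torus.lift datum = fun y : EuclideanSpace ℝ (Fin 2) => Real.sin (2 * Real.pi * y 0) := by
  funext y
  have hper : Function.Periodic (fun s : ℝ => Real.sin (2 * Real.pi * s)) 1 := fun s => by
    show Real.sin (2 * Real.pi * (s + 1)) = Real.sin (2 * Real.pi * s)
    rw [mul_add, mul_one, Real.sin_add_two_pi]
  exact FunctionSpaces.Torus.lift_coordFun_apply hper 0 y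

/-- `datum` is smooth. [folklore] -/
theorem isSmooth_datum : FunctionSpaces.Torus.IsSmooth datum := by
  change ContDiff ℝ _ (FunctionSpaces.Torus.lift datum)
  rw [lift_datum]
  fun_prop

/-- `|datum| ≤ 1`. [folklore] -/
theorem abs_datum_le_one (x : UnitAddTorus (Fin 2)) : |datum x| ≤ 1 := Real.abs_sin_le_one _

/-- The datum has positive energy `‖θ₀‖²_{L²} > 0`. [folklore] -/
theorem scalarL2Sq_datum_pos : 0 < FluidPDE.Torus.scalarL2Sq datum := by
  haveI : (volume : Measure (UnitAddTorus (Fin 2))).IsOpenPosMeasure := by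
    rw [volume_pi]; infer_instance
  unfold FluidPDE.Torus.scalarL2Sq
  have hc : Continuous fun x : UnitAddTorus (Fin 2) => datum x ^ 2 := (isSmooth_datum.continuous).pow 2
  -- the point with coordinates (1/4, 1/4): `datum = sin (π/2) = 1`
  set y : EuclideanSpace ℝ (Fin 2) := WithLp.toLp 2 (fun _ => (1 / 4 : ℝ)) with hy
  have hval : datum (FunctionSpaces.Torus.proj y) = 1 := by
    have h := congrFun lift_datum y
    simp only [FunctionSpaces.Torus.lift, Function.comp_apply] at h
    rw [h, hy]
    have e : (2 : ℝ) * Real.pi * (WithLp.toLp 2 (fun _ : Fin 2 => (1 / 4 : ℝ))).ofLp 0 = Real.pi / 2 := by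
      show (2 : ℝ) * Real.pi * (1 / 4) = Real.pi / 2
      ring
    rw [e, Real.sin_pi_div_two]
  refine hc.integral_pos_of_hasCompactSupport_nonneg_nonzero (HasCompactSupport.of_compactSpace _)
    (fun x => sq_nonneg _) (x := FunctionSpaces.Torus.proj y) ?_
  rw [hval]; norm_num


/-! ## §3 Energy bounds for a classical planar Navier–Stokes solution from rest with a bounded force on `[0,1)` -/

section Energy

variable {ν : ℝ} {G V : ℝ → UnitAddTorus (Fin 2) → EuclideanSpace ℝ (Fin 2)}
  {φ : ℝ → UnitAddTorus (Fin 2) → ℝ}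

/-- Cauchy–Schwarz on the probability torus: `∫⟪G, V⟫ ≤ C (∫‖V‖²)^{1/2}` if `‖G‖ ≤ C` pointwise. [folklore] -/
theorem integral_inner_le_of_norm_le {G V : UnitAddTorus (Fin 2) → EuclideanSpace ℝ (Fin 2)}
    (hG : Continuous G) (hV : Continuous V) {C : ℝ} (hC : ∀ x, ‖G x‖ ≤ C) :
    ∫ x, ⟪G x, V x⟫_ℝ ≤ C * Real.sqrt (∫ x, ‖V x‖ ^ 2) := by
  have hC0 : 0 ≤ C := (norm_nonneg _).trans (hC 0)
  have h1 : ∫ x, ⟪G x, V x⟫_ℝ ≤ ∫ x, C * (‖V x‖ * 1) := by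
    refine integral_mono (hG.inner hV).integrable_unitAddTorus
      ((continuous_const.mul (hV.norm.mul continuous_const)).integrable_unitAddTorus) fun x => ?_
    calc ⟪G x, V x⟫_ℝ ≤ ‖G x‖ * ‖V x‖ := real_inner_le_norm _ _
      _ ≤ C * (‖V x‖ * 1) := by
          rw [mul_one]; exact mul_le_mul_of_nonneg_right (hC x) (norm_nonneg _)
  have h2 : ∫ x, ‖V x‖ * (1 : ℝ) ≤ Real.sqrt (∫ x, ‖V x‖ ^ 2) * Real.sqrt (∫ _x : UnitAddTorus (Fin 2), (1 : ℝ) ^ 2) :=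
    FunctionSpaces.Torus.integral_mul_le_sqrt_mul_sqrt hV.norm continuous_const
  have h3 : Real.sqrt (∫ _x : UnitAddTorus (Fin 2), (1 : ℝ) ^ 2) = 1 := by simp
  rw [h3, mul_one] at h2
  rw [integral_const_mul] at h1
  exact h1.trans (mul_le_mul_of_nonneg_left h2 hC0)

/-- **Energy bound**: a classical Navier–Stokes solution on `[0,1) × 𝕋²` from rest with `ν ≥ 0` and a force bounded
by `C` pointwise has kinetic energy `½‖V(t)‖² ≤ C²/2` for all `t < 1` (energy balance, `d/dt E ≤ C√(2E)`, and the
`√`-comparison lemma of Bruè–De Lellis' Lemma 7). [folklore] -/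
theorem kineticEnergy_le_of_force_bound (hν : 0 ≤ ν)
    (hV : FunctionSpaces.Torus.IsClassicalNSSolutionOn (Ico (0 : ℝ) 1) ν G V φ) (h0 : V 0 = 0) {C : ℝ}
    (hC : ∀ t ∈ Ico (0 : ℝ) 1, ∀ x, ‖G t x‖ ≤ C) {t : ℝ} (ht : t ∈ Ico (0 : ℝ) 1) :
    FunctionSpaces.Torus.kineticEnergy (V t) ≤ C ^ 2 / 2 := by
  have hC0 : 0 ≤ C := (norm_nonneg _).trans (hC 0 ⟨le_rfl, zero_lt_one⟩ 0)
  rcases eq_or_lt_of_le ht.1 with h00 | htpos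
  · rw [← h00, h0]
    have : FunctionSpaces.Torus.kineticEnergy (0 : UnitAddTorus (Fin 2) → EuclideanSpace ℝ (Fin 2)) = 0 := by
      simp [FunctionSpaces.Torus.kineticEnergy]
    rw [this]; positivity
  have hU : UniqueDiffOn ℝ (Ico (0 : ℝ) 1) := uniqueDiffOn_Ico 0 1
  have hconv : Convex ℝ (Ico (0 : ℝ) 1) := convex_Ico 0 1
  have hI : Icc 0 t ⊆ Ico (0 : ℝ) 1 := fun s hs => ⟨hs.1, hs.2.trans_lt ht.2⟩
  have hGs : FunctionSpaces.Torus.IsSmoothSpaceTimeOn (Ico (0 : ℝ) 1) G := hV.smooth_force hU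
  have hVs := hV.smooth_velocity
  set E : ℝ → ℝ := fun s => FunctionSpaces.Torus.kineticEnergy (V s) with hE
  set D : ℝ → ℝ := fun s => -ν * FunctionSpaces.Torus.gradNormSq (V s) + ∫ x, ⟪G s x, V s x⟫_ℝ with hD
  have hderiv : ∀ s ∈ Icc 0 t, HasDerivWithinAt E (D s) (Icc 0 t) s := fun s hs =>
    (FunctionSpaces.Torus.IsClassicalNSSolutionOn.energy_balance_holds hV hconv (hI hs)).mono hI
  have hDc : ContinuousOn D (Icc 0 t) :=
    (((hVs.continuousOn_gradNormSq hconv hU).mono hI).const_smul (-ν)).add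
      (((hGs.inner hVs).continuousOn_integral hconv).mono hI)
  set g : ℝ → ℝ := fun _ => C * Real.sqrt 2 / 2 with hg
  have hle : ∀ s ∈ Icc 0 t, D s ≤ 2 * Real.sqrt (E s) * g s := by
    intro s hs
    have hs' : s ∈ Ico (0 : ℝ) 1 := hI hs
    have hGc : Continuous (G s) := (hGs.isSmooth_slice hs').continuous
    have hVc : Continuous (V s) := (hVs.isSmooth_slice hs').continuous
    have h1 : ∫ x, ⟪G s x, V s x⟫_ℝ ≤ C * Real.sqrt (∫ x, ‖V s x‖ ^ 2) :=
      integral_inner_le_of_norm_le hGc hVc (hC s hs')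
    have h2 : -ν * FunctionSpaces.Torus.gradNormSq (V s) ≤ 0 := by
      have := FunctionSpaces.Torus.gradNormSq_nonneg (V s)
      nlinarith
    have h3 : Real.sqrt (∫ x, ‖V s x‖ ^ 2) = Real.sqrt 2 * Real.sqrt (E s) := by
      have : (∫ x, ‖V s x‖ ^ 2) = 2 * E s := by
        simp only [hE, FunctionSpaces.Torus.kineticEnergy]; ring
      rw [this, Real.sqrt_mul (by norm_num : (0:ℝ) ≤ 2)]
    calc D s ≤ C * Real.sqrt (∫ x, ‖V s x‖ ^ 2) := by simp only [hD]; linarith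
      _ = 2 * Real.sqrt (E s) * g s := by rw [h3]; simp only [hg]; ring
  have hmain := FluidPDE.Torus.sqrt_le_sqrt_add_integral_of_hasDerivWithinAt htpos.le hderiv hDc
    (fun s _ => FunctionSpaces.Torus.kineticEnergy_nonneg _) hle
    (fun s _ => by simp only [hg]; positivity) (by simp only [hg]; exact intervalIntegrable_const)
  have hE0 : E 0 = 0 := by
    simp only [hE, h0]; simp [FunctionSpaces.Torus.kineticEnergy]
  rw [hE0, Real.sqrt_zero, zero_add, intervalIntegral.integral_const, smul_eq_mul] at hmain
  have hgt : (t - 0) * (C * Real.sqrt 2 / 2) ≤ C * Real.sqrt 2 / 2 := by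
    have : 0 ≤ C * Real.sqrt 2 / 2 := by positivity
    have ht1 : t - 0 ≤ 1 := by linarith [ht.2]
    nlinarith
  have hsq : Real.sqrt (E t) ≤ C * Real.sqrt 2 / 2 := hmain.trans hgt
  have hEt : E t = Real.sqrt (E t) ^ 2 := (Real.sq_sqrt (FunctionSpaces.Torus.kineticEnergy_nonneg _)).symm
  have h22 : Real.sqrt 2 ^ 2 = 2 := Real.sq_sqrt (by norm_num)
  calc FunctionSpaces.Torus.kineticEnergy (V t) = E t := rfl
    _ = Real.sqrt (E t) ^ 2 := hEt
    _ ≤ (C * Real.sqrt 2 / 2) ^ 2 := pow_le_pow_left₀ (Real.sqrt_nonneg _) hsq 2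
    _ = C ^ 2 / 2 := by rw [mul_div_assoc, mul_pow, div_pow, h22]; ring

/-- **Dissipation bound**: under the same hypotheses, `ν ∫₀ᵗ ‖∇V‖² ≤ C²` for all `t < 1` (energy equality).
[folklore] -/
theorem dissipation_le_of_force_bound (hν : 0 ≤ ν)
    (hV : FunctionSpaces.Torus.IsClassicalNSSolutionOn (Ico (0 : ℝ) 1) ν G V φ) (h0 : V 0 = 0) {C : ℝ}
    (hC : ∀ t ∈ Ico (0 : ℝ) 1, ∀ x, ‖G t x‖ ≤ C) {t : ℝ} (ht : t ∈ Ico (0 : ℝ) 1) :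
    ν * ∫ s in (0 : ℝ)..t, FunctionSpaces.Torus.gradNormSq (V s) ≤ C ^ 2 := by
  have hC0 : 0 ≤ C := (norm_nonneg _).trans (hC 0 ⟨le_rfl, zero_lt_one⟩ 0)
  have hU : UniqueDiffOn ℝ (Ico (0 : ℝ) 1) := uniqueDiffOn_Ico 0 1
  have hconv : Convex ℝ (Ico (0 : ℝ) 1) := convex_Ico 0 1
  have hI : Icc 0 t ⊆ Ico (0 : ℝ) 1 := fun s hs => ⟨hs.1, hs.2.trans_lt ht.2⟩
  have hGs : FunctionSpaces.Torus.IsSmoothSpaceTimeOn (Ico (0 : ℝ) 1) G := hV.smooth_force hU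
  have hVs := hV.smooth_velocity
  have heq := hV.energy_eq hconv ht.1 hI
  have hE0 : FunctionSpaces.Torus.kineticEnergy (V 0) = 0 := by
    rw [h0]; simp [FunctionSpaces.Torus.kineticEnergy]
  have hFc : ContinuousOn (fun s => ∫ x, ⟪G s x, V s x⟫_ℝ) (Icc 0 t) :=
    ((hGs.inner hVs).continuousOn_integral hconv).mono hI
  have hF : ∫ s in (0 : ℝ)..t, ∫ x, ⟪G s x, V s x⟫_ℝ ≤ ∫ _s in (0 : ℝ)..t, C * C := by
    refine intervalIntegral.integral_mono_on ht.1 (hFc.mono (by rw [uIcc_of_le ht.1])).intervalIntegrable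
      intervalIntegrable_const fun s hs => ?_
    have hs' : s ∈ Ico (0 : ℝ) 1 := hI hs
    have h1 := integral_inner_le_of_norm_le (hGs.isSmooth_slice hs').continuous
      (hVs.isSmooth_slice hs').continuous (hC s hs')
    have hEs := kineticEnergy_le_of_force_bound hν hV h0 hC hs'
    have h2 : Real.sqrt (∫ x, ‖V s x‖ ^ 2) ≤ C := by
      have : (∫ x, ‖V s x‖ ^ 2) = 2 * FunctionSpaces.Torus.kineticEnergy (V s) := by
        simp only [FunctionSpaces.Torus.kineticEnergy]; ring
      rw [this]
      calc Real.sqrt (2 * FunctionSpaces.Torus.kineticEnergy (V s)) ≤ Real.sqrt (C ^ 2) :=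
            Real.sqrt_le_sqrt (by linarith)
        _ = C := Real.sqrt_sq hC0
    exact h1.trans (mul_le_mul_of_nonneg_left h2 hC0)
  rw [intervalIntegral.integral_const, smul_eq_mul] at hF
  have ht1 : (t - 0) * (C * C) ≤ C ^ 2 := by
    have : t - 0 ≤ 1 := by linarith [ht.2]
    nlinarith
  have hEt := FunctionSpaces.Torus.kineticEnergy_nonneg (V t)
  linarith

end Energy

/-! ## §4 Scalars: dissipation bound and the `2½`-D dissipation floor -/

section Scalar

variable {ν : ℝ} {G V : ℝ → UnitAddTorus (Fin 2) → EuclideanSpace ℝ (Fin 2)}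
  {φ R : ℝ → UnitAddTorus (Fin 2) → ℝ}

/-- Scalar dissipation bound `ν∫₀ᵗ‖∇R‖² ≤ ‖R(0)‖²/2` on `[0,1)` (energy identity). [folklore] -/
theorem scalar_dissipation_le (hR : FluidPDE.Torus.IsClassicalScalarTransportOn (Ico (0 : ℝ) 1) ν V R)
    {t : ℝ} (ht : t ∈ Ico (0 : ℝ) 1) :
    ν * ∫ s in (0 : ℝ)..t, FluidPDE.Torus.scalarGradNormSq (R s) ≤ FluidPDE.Torus.scalarL2Sq (R 0) / 2 := by
  have hI : Icc 0 t ⊆ Ico (0 : ℝ) 1 := fun s hs => ⟨hs.1, hs.2.trans_lt ht.2⟩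
  have h := FluidPDE.Torus.IsClassicalScalarTransportOn.scalarL2Sq_add_scalarDissipation_holds hR ht.1 hI
  have h0 := FluidPDE.Torus.scalarL2Sq_nonneg (R t)
  simp only [FluidPDE.Torus.scalarDissipation] at h
  linarith

/-- **The `2½`-D dissipation floor**: for the lift `u = (V, R)∘π` of a classical planar Navier–Stokes solution from
rest with a bounded force and a classical scalar it transports (`ν > 0`), the gradient energy `t ↦ ‖∇u(t)‖²` is
interval integrable on `[0,1]` and `ν∫₀ᵀ‖∇R‖² ≤ ν∫₀¹‖∇u‖² = cumulativeDissipation ν u 0 1` for every `T < 1`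
(`‖∇u‖² = ‖∇V‖² + ‖∇R‖²`, `Torus.gradNormSq_twoHalf`). [folklore] -/
theorem scalar_dissipation_le_cumulativeDissipation_twoHalf (hν : 0 < ν)
    (hV : FunctionSpaces.Torus.IsClassicalNSSolutionOn (Ico (0 : ℝ) 1) ν G V φ) (h0 : V 0 = 0) {C : ℝ}
    (hC : ∀ t ∈ Ico (0 : ℝ) 1, ∀ x, ‖G t x‖ ≤ C)
    (hR : FluidPDE.Torus.IsClassicalScalarTransportOn (Ico (0 : ℝ) 1) ν V R) {T : ℝ} (hT : T ∈ Ico (0 : ℝ) 1) :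
    ν * ∫ s in (0 : ℝ)..T, FluidPDE.Torus.scalarGradNormSq (R s) ≤
      FunctionSpaces.Torus.cumulativeDissipation ν (fun t => twoHalf (V t) (R t)) 0 1 := by
  have hU : UniqueDiffOn ℝ (Ico (0 : ℝ) 1) := uniqueDiffOn_Ico 0 1
  have hconv : Convex ℝ (Ico (0 : ℝ) 1) := convex_Ico 0 1
  have hVs := hV.smooth_velocity
  have hRs := hR.smooth_scalar
  set g : ℝ → ℝ := fun t => FunctionSpaces.Torus.gradNormSq (V t) + FluidPDE.Torus.scalarGradNormSq (R t) with hg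
  have hgc : ContinuousOn g (Ico (0 : ℝ) 1) :=
    (hVs.continuousOn_gradNormSq hconv hU).add (hR.continuousOn_scalarGradNormSq hconv hU)
  have hgnn : ∀ t ∈ Ico (0 : ℝ) 1, 0 ≤ g t := fun t _ =>
    add_nonneg (FunctionSpaces.Torus.gradNormSq_nonneg _) (FluidPDE.Torus.scalarGradNormSq_nonneg _)
  -- bounded partial integrals
  have hgB : ∀ t ∈ Ico (0 : ℝ) 1, ∫ s in (0 : ℝ)..t, g s ≤ C ^ 2 / ν + FluidPDE.Torus.scalarL2Sq (R 0) / (2 * ν) := by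
    intro t ht
    have hI : Icc 0 t ⊆ Ico (0 : ℝ) 1 := fun s hs => ⟨hs.1, hs.2.trans_lt ht.2⟩
    have hsub : uIcc 0 t ⊆ Ico (0 : ℝ) 1 := by rw [uIcc_of_le ht.1]; exact hI
    have i1 : IntervalIntegrable (fun s => FunctionSpaces.Torus.gradNormSq (V s)) volume 0 t :=
      ((hVs.continuousOn_gradNormSq hconv hU).mono hsub).intervalIntegrable
    have i2 : IntervalIntegrable (fun s => FluidPDE.Torus.scalarGradNormSq (R s)) volume 0 t :=
      ((hR.continuousOn_scalarGradNormSq hconv hU).mono hsub).intervalIntegrable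
    have e : ∫ s in (0 : ℝ)..t, g s = (∫ s in (0 : ℝ)..t, FunctionSpaces.Torus.gradNormSq (V s)) +
        ∫ s in (0 : ℝ)..t, FluidPDE.Torus.scalarGradNormSq (R s) := intervalIntegral.integral_add i1 i2
    have b1 := dissipation_le_of_force_bound hν.le hV h0 hC ht
    have b2 := scalar_dissipation_le hR ht
    have b1' : ∫ s in (0 : ℝ)..t, FunctionSpaces.Torus.gradNormSq (V s) ≤ C ^ 2 / ν := by
      rw [le_div_iff₀ hν]; linarith
    have b2' : ∫ s in (0 : ℝ)..t, FluidPDE.Torus.scalarGradNormSq (R s) ≤ FluidPDE.Torus.scalarL2Sq (R 0) / (2 * ν) := by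
      rw [le_div_iff₀ (by positivity)]; linarith
    rw [e]; exact add_le_add b1' b2'
  have hgi : IntervalIntegrable g volume 0 1 := intervalIntegrable_of_integral_le hgc hgnn hgB
  -- the lift's gradient energy agrees with `g` on `[0,1)`
  set u : ℝ → UnitAddTorus (Fin 3) → EuclideanSpace ℝ (Fin 3) := fun t => twoHalf (V t) (R t) with hu
  have hug : ∀ t ∈ Ico (0 : ℝ) 1, FunctionSpaces.Torus.gradNormSq (u t) = g t := fun t ht =>
    FluidPDE.Torus.gradNormSq_twoHalf (hVs.isSmooth_slice ht) (hRs.isSmooth_slice ht)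
  have hui : IntervalIntegrable (fun t => FunctionSpaces.Torus.gradNormSq (u t)) volume 0 1 := by
    rw [intervalIntegrable_iff_integrableOn_Ioc_of_le zero_le_one, integrableOn_Ioc_iff_integrableOn_Ioo]
    have hgi' : IntegrableOn g (Ioo 0 1) volume := by
      have := (intervalIntegrable_iff_integrableOn_Ioc_of_le zero_le_one).1 hgi
      exact this.mono_set Ioo_subset_Ioc_self
    exact hgi'.congr_fun (fun t ht => (hug t (Ioo_subset_Ico_self ht)).symm) measurableSet_Ioo
  -- compare
  have hTI : uIcc 0 T ⊆ Ico (0 : ℝ) 1 := by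
    rw [uIcc_of_le hT.1]; exact fun s hs => ⟨hs.1, hs.2.trans_lt hT.2⟩
  have step1 : ∫ s in (0 : ℝ)..T, FluidPDE.Torus.scalarGradNormSq (R s) ≤ ∫ s in (0 : ℝ)..T, g s := by
    refine intervalIntegral.integral_mono_on hT.1
      ((hR.continuousOn_scalarGradNormSq hconv hU).mono hTI).intervalIntegrable
      (hgc.mono hTI).intervalIntegrable fun s _ => ?_
    simp only [hg]
    linarith [FunctionSpaces.Torus.gradNormSq_nonneg (V s)]
  have step2 : ∫ s in (0 : ℝ)..T, g s = ∫ s in (0 : ℝ)..T, FunctionSpaces.Torus.gradNormSq (u s) :=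
    intervalIntegral.integral_congr fun s hs => (hug s (hTI hs)).symm
  have step3 : ∫ s in (0 : ℝ)..T, FunctionSpaces.Torus.gradNormSq (u s) ≤
      ∫ s in (0 : ℝ)..1, FunctionSpaces.Torus.gradNormSq (u s) :=
    integral_le_integral_of_nonneg hui (fun s _ => FunctionSpaces.Torus.gradNormSq_nonneg _) hT.1 hT.2.le
  unfold FunctionSpaces.Torus.cumulativeDissipation
  exact mul_le_mul_of_nonneg_left (step1.trans (step2.le.trans step3)) hν.le

end Scalar


end Summit.AnomalousDissipation.AnomalousDissipation.Theorems.SawtoothPulseCascade.DriftFreeClosure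

end
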